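import Literature.Algebra.Lie.QuaternionCentralizerSkewDimensionOrthogonal
import Literature.Algebra.Lie.SymplecticAlgebraDimension
import Mathlib.LinearAlgebra.BilinearForm.Properties
import HarnessLib

/-!
# The Lefschetz counts `8 · dim (C(i, j) ∩ 𝔰𝔭(W, B)) = n² ∓ 2n` for a quaternion pair and a nondegenerate antisymmetric form
# over an arbitrary field

Topic `Literature/Algebra/Lie`.  Theorems only (no definition, no named fact), Mathlib vocabulary.  For a field `K` with `2 ≠ 0`,
a finite-dimensional `K`-space `W` with a NONDEGENERATE ANTISYMMETRIC bilinear form `B`, and an anticommuting pair `i² = a`,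
`j² = b` (`a, b ∈ K×`) of endomorphisms: if `i, j` are `B`-skew (the canonical involution — Albert type III) then
`8 · dim_K (C(i, j) ∩ 𝔰𝔭(W, B)) + 2n = n²` (`n = dim_K W`; Milne's `dim S = g²/2f − g/2` per place), and if `i` is `B`-skew and
`j` is `B`-symmetric (the involution `x ↦ u⁻¹x̄u` — Albert type II) then `8 · dim_K (C(i, j) ∩ 𝔰𝔭(W, B)) = n² + 2n`.  These are the
field-`K` forms of `CorCM/MumfordTateRankTypeThreeLefschetz` §2 / `CorCM/MumfordTateRankTypeTwoLefschetz` §2 (stated there for a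
polarized `ℚ`-Hodge structure through `Polarization.adjoint`), obtained from the algebra counts of
`QuaternionCentralizerSkewDimension{,Orthogonal}` and the basis-free `dim 𝔰𝔭 = n(n+1)/2` of `SymplecticAlgebraDimension` once
the `B`-adjoint `τ` is packaged as a linear anti-involution of `End_K W` with `ker(τ + 1) = 𝔰𝔭(W, B)`
(`exists_adjoint_antiInvolution`, from Mathlib's `LinearMap.BilinForm.leftAdjointOfNondegenerate`).  Written for the cell
`pub-hodgecm2` (COR-CM), seat `b27`, count-neutral Mumford–Tate-rank lane: with the trace-form descent `ψ = Tr_{F/ℚ} ∘ ψ_F`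
(`Literature/LinearAlgebra/QuadraticForm/TraceFormDescent`) they give the Lefschetz bounds `e · m(2m ∓ 1)` for types III(e)/II(e).

* `exists_adjoint_antiInvolution` — the `B`-adjoint as a `K`-linear anti-involution `τ` with `B(τX x, y) = B(x, X y)` and
  `ker(τ + 1) = B.skewAdjointSubmodule`.
* **`eight_mul_finrank_centralizer_inf_skewAdjoint_add`** (both skew), **`eight_mul_finrank_centralizer_inf_skewAdjoint_orth`**
  (`i` skew, `j` symmetric).

## References
* [Milne1999LefschetzClasses] J. S. Milne, Duke Math. J. 96 (1999), §2 (types II, III) and Summary (`g²/2f ± g/2`).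
* [Humphreys1972] J. E. Humphreys, GTM 9 (1972), §1.2 (`dim C_l = 2l² + l`).
-/

namespace Literature.Algebra.Lie

namespace QuaternionCentralizerForm

open Module

variable {K : Type*} [Field K] {W : Type*} [AddCommGroup W] [Module K W] [FiniteDimensional K W]

/-- **The adjoint of a nondegenerate antisymmetric form as a linear anti-involution**: there is a `K`-linear
`τ : End W → End W` with `B(τX x, y) = B(x, X y)`, `τ(XY) = τY τX`, `τ τ = id`, and `ker(τ + 1) = 𝔰𝔭(W, B)` (the `B`-skew
endomorphisms).  (`τ X` is Mathlib's `B.leftAdjointOfNondegenerate`, unique by non-degeneracy; `τ² = 1` uses antisymmetry.)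
[cite: Humphreys1972, §1.2] -/
theorem exists_adjoint_antiInvolution (B : LinearMap.BilinForm K W) (hB : B.Nondegenerate) (hflip : B.flip = -B) :
    ∃ τ : Module.End K W →ₗ[K] Module.End K W, (∀ X x y, B (τ X x) y = B x (X y)) ∧ (∀ X Y, τ (X * Y) = τ Y * τ X) ∧
      (∀ X, τ (τ X) = X) ∧ LinearMap.ker (τ + LinearMap.id) = B.skewAdjointSubmodule := by
  have hanti : ∀ u v : W, B v u = -(B u v) := fun u v => by
    have h := LinearMap.congr_fun₂ hflip u v
    simpa only [LinearMap.BilinForm.flip_apply, LinearMap.neg_apply] using h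
  have hadj : ∀ (X : Module.End K W) (x y : W), B (B.leftAdjointOfNondegenerate hB X x) y = B x (X y) :=
    fun X x y => B.isAdjointPairLeftAdjointOfNondegenerate hB X x y
  have huniq : ∀ X Y : Module.End K W, (∀ x y, B (Y x) y = B x (X y)) → Y = B.leftAdjointOfNondegenerate hB X :=
    fun X Y h => (B.isAdjointPair_iff_eq_of_nondegenerate hB Y X).1 h
  let τ : Module.End K W →ₗ[K] Module.End K W :=
    { toFun := B.leftAdjointOfNondegenerate hB
      map_add' := fun X Y => (huniq _ _ fun x y => by
        simp only [LinearMap.add_apply, map_add, hadj]).symm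
      map_smul' := fun c X => (huniq _ _ fun x y => by
        simp only [RingHom.id_apply, LinearMap.smul_apply, map_smul, hadj]).symm }
  have hτ : ∀ X, τ X = B.leftAdjointOfNondegenerate hB X := fun _ => rfl
  have hτadj : ∀ X x y, B (τ X x) y = B x (X y) := fun X x y => hadj X x y
  refine ⟨τ, hτadj, fun X Y => ?_, fun X => ?_, ?_⟩
  · rw [hτ (X * Y)]
    exact (huniq _ _ fun x y => by simp only [Module.End.mul_apply, hτadj]).symm
  · rw [hτ (τ X)]
    refine (huniq _ _ fun x y => ?_).symm
    rw [hanti (τ X y) x, hτadj, hanti (X x) y, neg_neg]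
  · ext X
    rw [LinearMap.mem_ker, LinearMap.add_apply, LinearMap.id_apply, add_eq_zero_iff_eq_neg, LinearMap.mem_skewAdjointSubmodule]
    constructor
    · intro h x y
      rw [Pi.neg_apply, map_neg, ← hτadj X x y, h, LinearMap.neg_apply, map_neg, LinearMap.neg_apply, neg_neg]
    · intro h
      rw [hτ]
      refine (huniq X (-X) fun x y => ?_).symm
      have h2 := h x y
      rw [Pi.neg_apply, map_neg] at h2
      rw [LinearMap.neg_apply, map_neg, LinearMap.neg_apply, h2, neg_neg]

variable [NeZero (2 : K)]

/-- **`8 · dim_K (C(i, j) ∩ 𝔰𝔭(W, B)) + 2n = n²`** for a nondegenerate antisymmetric `B` on `W` (`n = dim_K W`) and an anticommuting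
pair `i² = a`, `j² = b` (`a, b ≠ 0`) of `B`-SKEW endomorphisms (Albert type III: the canonical involution):
`8 dim C⁻ + 4 dim 𝔰𝔭 = 3 dim End` and `2 dim 𝔰𝔭 = n(n+1)`. [cite: Milne1999LefschetzClasses, §2 (type III) and Summary] -/
theorem eight_mul_finrank_centralizer_inf_skewAdjoint_add (B : LinearMap.BilinForm K W) (hB : B.Nondegenerate)
    (hflip : B.flip = -B) {i j : Module.End K W} {a b : K} (ha : a ≠ 0) (hb : b ≠ 0) (hi : i * i = algebraMap K _ a)
    (hj : j * j = algebraMap K _ b) (hij : i * j = -(j * i)) (hiB : B.IsSkewAdjoint i) (hjB : B.IsSkewAdjoint j) :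
    8 * finrank K ↥(Subalgebra.toSubmodule (Subalgebra.centralizer K ({i, j} : Set (Module.End K W))) ⊓
        B.skewAdjointSubmodule) + 2 * finrank K W = finrank K W * finrank K W := by
  obtain ⟨τ, -, hτm, hττ, hker⟩ := exists_adjoint_antiInvolution B hB hflip
  have hτi : τ i = -i := by
    have h : i ∈ LinearMap.ker (τ + LinearMap.id) := by rw [hker, LinearMap.mem_skewAdjointSubmodule]; exact hiB
    rwa [LinearMap.mem_ker, LinearMap.add_apply, LinearMap.id_apply, add_eq_zero_iff_eq_neg] at h
  have hτj : τ j = -j := by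
    have h : j ∈ LinearMap.ker (τ + LinearMap.id) := by rw [hker, LinearMap.mem_skewAdjointSubmodule]; exact hjB
    rwa [LinearMap.mem_ker, LinearMap.add_apply, LinearMap.id_apply, add_eq_zero_iff_eq_neg] at h
  have hs := SymplecticDimension.two_mul_finrank_skewAdjointSubmodule_of_flip_eq_neg B hB hflip
  have hE : finrank K (Module.End K W) = finrank K W * finrank K W := Module.finrank_linearMap _ _ _ _
  have hcount := QuaternionCentralizer.eight_mul_finrank_centralizer_skew_add (K := K) (E := Module.End K W) ha hb hi hj hij
    τ hτm hττ hτi hτj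
  rw [hker, hE] at hcount
  zify at hcount hs ⊢
  linear_combination hcount - 2 * hs

/-- **`8 · dim_K (C(i, j) ∩ 𝔰𝔭(W, B)) = n² + 2n`** for a nondegenerate antisymmetric `B` on `W` and an anticommuting pair
`i² = a`, `j² = b` (`a, b ≠ 0`) with `i` `B`-SKEW and `j` `B`-SYMMETRIC (Albert type II: the involution `x ↦ u⁻¹x̄u`):
`8 dim C⁻ + dim End = 4 dim 𝔰𝔭` and `2 dim 𝔰𝔭 = n(n+1)`. [cite: Milne1999LefschetzClasses, §2 (type II) and Summary] -/
theorem eight_mul_finrank_centralizer_inf_skewAdjoint_orth (B : LinearMap.BilinForm K W) (hB : B.Nondegenerate)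
    (hflip : B.flip = -B) {i j : Module.End K W} {a b : K} (ha : a ≠ 0) (hb : b ≠ 0) (hi : i * i = algebraMap K _ a)
    (hj : j * j = algebraMap K _ b) (hij : i * j = -(j * i)) (hiB : B.IsSkewAdjoint i)
    (hjB : LinearMap.IsAdjointPair B B j j) :
    8 * finrank K ↥(Subalgebra.toSubmodule (Subalgebra.centralizer K ({i, j} : Set (Module.End K W))) ⊓
        B.skewAdjointSubmodule) = finrank K W * finrank K W + 2 * finrank K W := by
  obtain ⟨τ, hτadj, hτm, hττ, hker⟩ := exists_adjoint_antiInvolution B hB hflip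
  have hτi : τ i = -i := by
    have h : i ∈ LinearMap.ker (τ + LinearMap.id) := by rw [hker, LinearMap.mem_skewAdjointSubmodule]; exact hiB
    rwa [LinearMap.mem_ker, LinearMap.add_apply, LinearMap.id_apply, add_eq_zero_iff_eq_neg] at h
  have hτj : τ j = j := by
    -- `τ j` and `j` are both left adjoint to `j`
    refine LinearMap.ext fun x => ?_
    rw [← sub_eq_zero]
    refine hB.1 _ fun y => ?_
    rw [map_sub, LinearMap.sub_apply, hτadj, ← hjB x y, sub_self]
  have hs := SymplecticDimension.two_mul_finrank_skewAdjointSubmodule_of_flip_eq_neg B hB hflip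
  have hE : finrank K (Module.End K W) = finrank K W * finrank K W := Module.finrank_linearMap _ _ _ _
  have hcount := QuaternionCentralizer.eight_mul_finrank_centralizer_skew_add_orth (K := K) (E := Module.End K W) ha hb hi
    hj hij τ hτm hττ hτi hτj
  rw [hker, hE] at hcount
  zify at hcount hs ⊢
  linear_combination hcount + 2 * hs

end QuaternionCentralizerForm

end Literature.Algebra.Lie
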